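import Literature.MathematicalPhysics.QuantumFieldTheory.BalabanImbrieJaffe1984to88.BIJ88Ineq5144OneCube

/-!
# `BalabanImbrieJaffe1984to88.BIJ88SlotFieldGaussBounds` — T. Bałaban, J. Imbrie, A. Jaffe, *Effective action and cluster properties of the abelian
Higgs model*, Commun. Math. Phys. **114** (1988) 257–315 [BalabanImbrieJaffe1988], Sect. 5.13–5.14, pp. 304–309 [PDF 48–53]: **THE ONE-CUBE GAUSSIAN
TAIL HYPOTHESES OF THE LEAF (5.14.4) DISCHARGED FROM STRUCTURAL DATA OF THE §5.13 MODEL** — mean and variance of a linear slot field under the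
law of one cube, from a lower bound on the form `Δ`, a Euclidean bound on the slot functional, and the size of the source on the cube.

statement-level skeleton of published theorems with citation tags; proofs where landed; nothing here is a claim about the Yang–Mills mass gap

p. 304 (last display) / p. 305: the §5.13 measures are the normalized Gaussians `e^{−½⟨Φ,Δ_sΦ⟩+⟨Φ,ℱ⟩}dΦ` restricted to regions; p. 308: the χ-slot
fields are linear functionals of the field (`χ(cp(e_k), (I − Q_s*Q)A^{(k)})`, components of `A^{(k)}`, `φ^{(k)}`); p. 307: *"Functional derivatives
hitting χ-factors … produce factors e^{−cp(e_k)²} after integrating with respect to A^{(k)″}, φ^{(k)″}. These derivatives are supported at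
|A^{(k)″}| ≧ cp(e_k) or |φ^{(k)″}| ≧ cp(e_k) (here we use the fact that the translation vanishes). Thus we can use the arguments at the end of
Sect. 14 in [3] to extract the factors e^{−cp(e_k)²} from the Gaussian measure."*  PDF held: `paper:balaban1988-cmp114-bij-abelian-higgs-effective-action`
(journal page = PDF page + 256); pp. 304–309 = PDF 48–53 read this generation (text layer p0050/p0051 re-read 2026-08-22).

WHY (row bookkeeping).  The one-cube part of the located leaf (5.14.4) is a theorem of the tree (`BIJ88Ineq5144OneCube.ineq5144_locAct_singleton_of_const`,
p36 gen 15) modulo ONE analytic input per χ-slot: a sub-Gaussian tail `law(□_i){a ≤ |Φ_b|} ≤ Ae^{−κa²}` (`htail`), or — for linear / modulus slot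
fields, `…_of_mod` — a mean bound `μ₀` and a variance bound `v` under the one-cube law.  This file computes mean and variance of a linear slot field
under `law(□)` EXACTLY and bounds them by STRUCTURAL data, so that the tail input is discharged from: (i) `Δ ≥ m·1` as a quadratic form on all fields
(`m > 0`; print: `Δ` is the positive form of (5.13.1)), (ii) `|ℓ(φ)| ≤ Λ‖φ‖₂` for the slot functional (print: bounded coefficient vectors of
`(I − Q_s*Q)A`, `φ`), (iii) `‖ℱ|_□‖₂ ≤ F` for the source on the cube (print p. 307: *"the translation vanishes"* — `ℱ = 0` on the cubes that matter,
`F = 0`, mean `0`).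

WHAT IS PROVED (unit `lit-balaban-p36`, generation 16 of the Phase-2 proof seat p36; rows **C2.Eq5.14.3-5.14.4** / **C2.Eq5.14.5** member cells of
`HOME/lit-balaban-r16/ROWS-C2-part2.md`, owner r16), theorems only:
* §1 Euclidean algebra: `dotProduct_inv_mulVec_le` (`P ≥ m ⇒ a·P⁻¹a ≤ ‖a‖²/m`), `inv_mulVec_dotProduct_self_le` (`‖P⁻¹f‖² ≤ ‖f‖²/m²`),
  `abs_dotProduct_inv_mulVec_le` (`|a·P⁻¹f| ≤ ‖a‖‖f‖/m`) — for a positive definite `P` with `m‖v‖² ≤ v·Pv`.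
* §2 `variance_dotProduct_gaussProb` — **`Var[t·x; dμ_{M⁻¹}] = t·M⁻¹t`** for the tree's probability Gaussian `gaussProb M` (`M ≻ 0`), from Mathlib's
  `covarianceBilin_multivariateGaussian` through the tree's `gaussProb_eq_map_multivariateGaussian`.
* §3 The law of one region `W` (`BIJ88SlotMomentsGauss308.fieldLaw blk Δ ℱ W`, precision `Δ|_W` = `prec blk Δ W 1_W`, mean `(Δ|_W)⁻¹ℱ|_W`):
  `prec_corner_self_apply` (`Δ|_W` entrywise), `ext_dotProduct_ext`, `ext_dotProduct_mulVec_ext`, `dotProduct_prec_mulVec_ge` (`Δ ≥ m ⇒ Δ|_W ≥ m`),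
  `linear_ext_eq_dotProduct` (a linear functional of the extended field is `ω ↦ a·ω`, `a_x = ℓ(ext δ_x)`), **`variance_linear_fieldLaw`**
  (`Var[ℓ(ext ω)] = a·(Δ|_W)⁻¹a`), `dotProduct_coef_self_le` (`‖a‖² ≤ Λ²`), **`variance_linear_fieldLaw_le`** (`≤ Λ²/m`),
  `integral_linear_fieldLaw_eq_dotProduct` (`E ℓ(ext ω) = a·(Δ|_W)⁻¹ℱ|_W`, gen 11's `integral_slotField_fieldLaw`), **`abs_integral_linear_fieldLaw_le`**
  (`|E ℓ(ext ω)| ≤ ΛF/m`).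
* §4 **`tail_slotField_fieldLaw_of_struct`** — for a slot field `ℓ₁` or `√(ℓ₁² + ℓ₂²)` with `|ℓ_j φ| ≤ Λ‖φ‖₂`: `law(W){a ≤ |Φ_b|} ≤
  4e^{F²/(2m)}e^{−(m/(8Λ²))a²}` (gen 13's `BIJ88GaussShellModulus309.tail_slotField_fieldLaw_of_mod` with `μ₀ = ΛF/m`, `v = Λ²/m`).
* §5 **`ineq5144_locAct_singleton_of_struct`** — THE ONE-CUBE PART OF (5.14.4) with the tail input replaced by `(m, Λ, F)`: p36 gen 15's
  `ineq5144_locAct_singleton_of_const` with `A = 4e^{F²/(2m)}`, `κ = m/(8Λ²)` supplied by §4 for every χ-slot on every cube.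
HONEST SCOPE: Gaussian bookkeeping in the finite-dimensional §5.13 model of record; the structural hypotheses (i)–(iii) are of print's kind but
print's constants (the covariance bounds of Sect. 2, the small-field sizes `p(e_k)`) are NOT derived here; nothing inter-cube.  0 `sorry`,
0 definitions, 0 `Prop` facts (D-0026); imports `BIJ88Ineq5144OneCube` (p36 g15) only; modifies nothing.  NOT summit progress; NOT continuum; NOT
Clay.  Cell `lit-balaban` Phase 2, seat p36 gen 16 (owner r16, referee ref-5).
-/

noncomputable section

open Finset MeasureTheory ProbabilityTheory Matrix
open Literature.MathematicalPhysics.QuantumFieldTheory.Balaban1983to89.B2Eq228Conditioning (gaussProb gaussProb_eq_map_multivariateGaussian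
  isProbabilityMeasure_gaussProb)
open Literature.MathematicalPhysics.QuantumFieldTheory.BalabanImbrieJaffe1984to88
open BIJ88DirichletForms305 (interpForm interpForm_apply)
open BIJ88PolymerRep5134 (corner corner_apply)
open BIJ88PolymerRep5134Gauss (ext prec src)
open BIJ88SlotMomentsGauss308 (fieldLaw continuous_ext)
open BIJ88EffectiveActionGauss308 (fieldLaw_eq_map_gaussProb isLinearMap_ext integral_slotField_fieldLaw)
open BIJ88Eq5145CornerModel (prec_corner_posDef slotB slotY)
open BIJ88Sect2Statements (pLog)
open BIJ88Sect5Statements (CutoffProfile cutoff)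
open BIJ88Eq5145CornerUrsell (cubeIn)
open BIJ88W6PrimeVsupp (actIn)
open BIJ88Ineq5144Located (locAct)

namespace Literature.MathematicalPhysics.QuantumFieldTheory.BalabanImbrieJaffe1984to88.BIJ88SlotFieldGaussBounds

/-! ## §1 Euclidean algebra: a positive definite matrix bounded below by `m` -/

section LinAlg

variable {n : Type*} [Fintype n] [DecidableEq n] {P : Matrix n n ℝ} {m : ℝ}

omit [DecidableEq n] in
/-- Cauchy–Schwarz with square roots: `|u·v| ≤ ‖u‖‖v‖` (`Finset.sum_mul_sq_le_sq_mul_sq`). [cite: BalabanImbrieJaffe1988, p.304 (Sect. 5.13)] -/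
theorem abs_dotProduct_le_sqrt_mul_sqrt (u v : n → ℝ) : |u ⬝ᵥ v| ≤ Real.sqrt (u ⬝ᵥ u) * Real.sqrt (v ⬝ᵥ v) := by
  have hu : 0 ≤ u ⬝ᵥ u := Finset.sum_nonneg fun i _ => mul_self_nonneg (u i)
  have hcs : (u ⬝ᵥ v) ^ 2 ≤ (u ⬝ᵥ u) * (v ⬝ᵥ v) := by
    simpa only [dotProduct, pow_two] using Finset.sum_mul_sq_le_sq_mul_sq Finset.univ u v
  rw [← Real.sqrt_mul hu, ← Real.sqrt_sq_eq_abs]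
  exact Real.sqrt_le_sqrt hcs

/-- **`P ≥ m ⇒ a·P⁻¹a ≤ ‖a‖²/m`** (`P ≻ 0`, `m > 0`): with `u = P⁻¹a`, `a·u = u·Pu ≥ m‖u‖²` and `(a·u)² ≤ ‖a‖²‖u‖²`.
[cite: BalabanImbrieJaffe1988, p.304 (Sect. 5.13)] -/
theorem dotProduct_inv_mulVec_le (hP : P.PosDef) (hm : 0 < m) (hPm : ∀ v : n → ℝ, m * (v ⬝ᵥ v) ≤ v ⬝ᵥ (P *ᵥ v)) (a : n → ℝ) :
    a ⬝ᵥ (P⁻¹ *ᵥ a) ≤ a ⬝ᵥ a / m := by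
  set u : n → ℝ := P⁻¹ *ᵥ a with hu
  have hPu : P *ᵥ u = a := by
    rw [hu, mulVec_mulVec, mul_nonsing_inv _ hP.det_pos.ne'.isUnit, one_mulVec]
  have hq : a ⬝ᵥ u = u ⬝ᵥ (P *ᵥ u) := by rw [hPu, dotProduct_comm]
  have h1 : m * (u ⬝ᵥ u) ≤ a ⬝ᵥ u := hq ▸ hPm u
  have h2 : (a ⬝ᵥ u) ^ 2 ≤ (a ⬝ᵥ a) * (u ⬝ᵥ u) := by
    simpa only [dotProduct, pow_two] using Finset.sum_mul_sq_le_sq_mul_sq Finset.univ a u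
  have ha0 : 0 ≤ a ⬝ᵥ a := Finset.sum_nonneg fun i _ => mul_self_nonneg (a i)
  rw [le_div_iff₀ hm]
  rcases le_or_gt (a ⬝ᵥ u) 0 with hle | hpos
  · nlinarith [ha0]
  · have h3 : (a ⬝ᵥ u) * (a ⬝ᵥ u) * m ≤ (a ⬝ᵥ a) * (a ⬝ᵥ u) := by
      calc (a ⬝ᵥ u) * (a ⬝ᵥ u) * m = (a ⬝ᵥ u) ^ 2 * m := by ring
        _ ≤ (a ⬝ᵥ a) * (u ⬝ᵥ u) * m := by gcongr
        _ = (a ⬝ᵥ a) * (m * (u ⬝ᵥ u)) := by ring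
        _ ≤ (a ⬝ᵥ a) * (a ⬝ᵥ u) := by gcongr
    exact le_of_mul_le_mul_right (by nlinarith [h3]) hpos

/-- **`P ≥ m ⇒ ‖P⁻¹f‖² ≤ ‖f‖²/m²`**: with `u = P⁻¹f`, `m‖u‖² ≤ u·Pu = u·f ≤ ‖u‖‖f‖`. [cite: BalabanImbrieJaffe1988, p.304 (Sect. 5.13)] -/
theorem inv_mulVec_dotProduct_self_le (hP : P.PosDef) (hm : 0 < m) (hPm : ∀ v : n → ℝ, m * (v ⬝ᵥ v) ≤ v ⬝ᵥ (P *ᵥ v)) (f : n → ℝ) :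
    (P⁻¹ *ᵥ f) ⬝ᵥ (P⁻¹ *ᵥ f) ≤ f ⬝ᵥ f / m ^ 2 := by
  set u : n → ℝ := P⁻¹ *ᵥ f with hu
  have hPu : P *ᵥ u = f := by
    rw [hu, mulVec_mulVec, mul_nonsing_inv _ hP.det_pos.ne'.isUnit, one_mulVec]
  have h1 : m * (u ⬝ᵥ u) ≤ u ⬝ᵥ f := hPu ▸ hPm u
  have h2 : (u ⬝ᵥ f) ^ 2 ≤ (u ⬝ᵥ u) * (f ⬝ᵥ f) := by
    simpa only [dotProduct, pow_two] using Finset.sum_mul_sq_le_sq_mul_sq Finset.univ u f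
  have hu0 : 0 ≤ u ⬝ᵥ u := Finset.sum_nonneg fun i _ => mul_self_nonneg (u i)
  rw [le_div_iff₀ (pow_pos hm 2)]
  rcases hu0.eq_or_lt with h0 | hpos
  · rw [← h0, zero_mul]; exact Finset.sum_nonneg fun i _ => mul_self_nonneg (f i)
  · have h3 : (m * (u ⬝ᵥ u)) ^ 2 ≤ (u ⬝ᵥ u) * (f ⬝ᵥ f) :=
      (pow_le_pow_left₀ (mul_nonneg hm.le hu0) h1 2).trans h2
    have h4 : (u ⬝ᵥ u) * ((u ⬝ᵥ u) * m ^ 2) ≤ (u ⬝ᵥ u) * (f ⬝ᵥ f) := by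
      calc (u ⬝ᵥ u) * ((u ⬝ᵥ u) * m ^ 2) = (m * (u ⬝ᵥ u)) ^ 2 := by ring
        _ ≤ (u ⬝ᵥ u) * (f ⬝ᵥ f) := h3
    exact le_of_mul_le_mul_left h4 hpos

/-- **`|a·P⁻¹f| ≤ ‖a‖‖f‖/m`**. [cite: BalabanImbrieJaffe1988, p.304 (Sect. 5.13)] -/
theorem abs_dotProduct_inv_mulVec_le (hP : P.PosDef) (hm : 0 < m) (hPm : ∀ v : n → ℝ, m * (v ⬝ᵥ v) ≤ v ⬝ᵥ (P *ᵥ v)) (a f : n → ℝ) :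
    |a ⬝ᵥ (P⁻¹ *ᵥ f)| ≤ Real.sqrt (a ⬝ᵥ a) * Real.sqrt (f ⬝ᵥ f) / m := by
  have h1 := abs_dotProduct_le_sqrt_mul_sqrt a (P⁻¹ *ᵥ f)
  have h2 : Real.sqrt ((P⁻¹ *ᵥ f) ⬝ᵥ (P⁻¹ *ᵥ f)) ≤ Real.sqrt (f ⬝ᵥ f) / m := by
    calc Real.sqrt ((P⁻¹ *ᵥ f) ⬝ᵥ (P⁻¹ *ᵥ f)) ≤ Real.sqrt (f ⬝ᵥ f / m ^ 2) :=
          Real.sqrt_le_sqrt (inv_mulVec_dotProduct_self_le hP hm hPm f)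
      _ = Real.sqrt (f ⬝ᵥ f) / m := by
          have hf0 : 0 ≤ f ⬝ᵥ f := Finset.sum_nonneg fun i _ => mul_self_nonneg (f i)
          rw [Real.sqrt_div hf0, Real.sqrt_sq hm.le]
  calc |a ⬝ᵥ (P⁻¹ *ᵥ f)| ≤ Real.sqrt (a ⬝ᵥ a) * Real.sqrt ((P⁻¹ *ᵥ f) ⬝ᵥ (P⁻¹ *ᵥ f)) := h1
    _ ≤ Real.sqrt (a ⬝ᵥ a) * (Real.sqrt (f ⬝ᵥ f) / m) := by gcongr
    _ = Real.sqrt (a ⬝ᵥ a) * Real.sqrt (f ⬝ᵥ f) / m := by ring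

end LinAlg

/-! ## §2 The variance of a linear functional under the probability Gaussian `dμ_{M⁻¹}` -/

section Gauss

variable {n : Type} [Fintype n] [DecidableEq n]

/-- **`Var[t·x; dμ_{M⁻¹}] = t·M⁻¹t`** for the tree's probability Gaussian measure `gaussProb M` of covariance `M⁻¹` (`M ≻ 0`) — Mathlib's
`covarianceBilin_multivariateGaussian` read through `gaussProb_eq_map_multivariateGaussian`. [cite: BalabanImbrieJaffe1988, p.304 (Sect. 5.13)] -/
theorem variance_dotProduct_gaussProb {M : Matrix n n ℝ} (hM : M.PosDef) (t : n → ℝ) :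
    Var[fun x : n → ℝ => t ⬝ᵥ x; gaussProb M] = t ⬝ᵥ (M⁻¹ *ᵥ t) := by
  have hS : (M⁻¹).PosSemidef := hM.posSemidef.inv
  rw [gaussProb_eq_map_multivariateGaussian hM, variance_map_equiv]
  have h1 : (fun x : n → ℝ => t ⬝ᵥ x) ∘ ⇑(MeasurableEquiv.toLp 2 (n → ℝ)).symm =
      fun u : EuclideanSpace ℝ n => @inner ℝ _ _ (WithLp.toLp 2 t) u := by
    funext u
    simp only [Function.comp_apply, MeasurableEquiv.toLp_symm_apply, EuclideanSpace.inner_eq_star_dotProduct, star_trivial, dotProduct_comm]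
  rw [h1, ← covarianceBilin_self IsGaussian.memLp_two_id, covarianceBilin_multivariateGaussian hS]

end Gauss

/-! ## §3 The law of one region: precision `Δ|_W`, mean and variance of a linear slot field, structural bounds -/

section Region

variable {α I : Type} [Fintype α] [DecidableEq α] [Fintype I] [DecidableEq I]
  (blk : α → I) (Δ : Matrix α α ℝ) (ℱ : α → ℝ) (W : Finset I)

/-- **the precision of the law of the region `W` is the block `Δ|_W`**: at the corner `1_W` all cubes of `W` are coupled (p. 305: `(Δ_s)_{xy} =
s_is_{i′}Δ_{xy}` across cubes, `= Δ_{xy}` inside one). [cite: BalabanImbrieJaffe1988, p.305 (Sect. 5.13)] -/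
theorem prec_corner_self_apply (x y : {x : α // blk x ∈ W}) : prec blk Δ W (corner ℝ W) x y = Δ x.1 y.1 := by
  simp only [prec, submatrix_apply]
  rw [interpForm_apply, corner_apply, corner_apply, if_pos x.2, if_pos y.2]
  split_ifs <;> ring

omit [DecidableEq α] [Fintype I] in
/-- sums of functions vanishing off the sites of `W` are sums over the sites of `W`. [cite: BalabanImbrieJaffe1988, p.306 (Sect. 5.13)] -/
theorem sum_eq_sum_site {g : α → ℝ} (hg : ∀ x, blk x ∉ W → g x = 0) : ∑ x, g x = ∑ x : {x : α // blk x ∈ W}, g x.1 := by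
  rw [← Finset.sum_subtype (univ.filter fun x => blk x ∈ W) (by simp) g]
  exact (Finset.sum_filter_of_ne fun x _ hx => by by_contra h; exact hx (hg x h)).symm

omit [DecidableEq α] [Fintype I] in
/-- the extension by zero is an isometry: `ext v · ext w = v · w`. [cite: BalabanImbrieJaffe1988, p.306 (Sect. 5.13)] -/
theorem ext_dotProduct_ext (v w : {x : α // blk x ∈ W} → ℝ) : ext blk W v ⬝ᵥ ext blk W w = v ⬝ᵥ w := by
  unfold dotProduct
  rw [sum_eq_sum_site blk W (g := fun x => ext blk W v x * ext blk W w x) (fun x hx => by simp [BIJ88PolymerRep5134Gauss.ext, hx])]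
  refine Finset.sum_congr rfl fun x _ => ?_
  simp [BIJ88PolymerRep5134Gauss.ext, x.2]

/-- the form `Δ` on extended fields is the block `Δ|_W` on the fields of `W`: `ext v · Δ ext v = v · Δ|_W v`.
[cite: BalabanImbrieJaffe1988, p.305 (Sect. 5.13)] -/
theorem ext_dotProduct_mulVec_ext (v : {x : α // blk x ∈ W} → ℝ) :
    ext blk W v ⬝ᵥ (Δ *ᵥ ext blk W v) = v ⬝ᵥ (prec blk Δ W (corner ℝ W) *ᵥ v) := by
  unfold dotProduct
  rw [sum_eq_sum_site blk W (g := fun x => ext blk W v x * (Δ *ᵥ ext blk W v) x) (fun x hx => by simp [BIJ88PolymerRep5134Gauss.ext, hx])]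
  refine Finset.sum_congr rfl fun x _ => ?_
  have hx : ext blk W v x.1 = v x := by simp [BIJ88PolymerRep5134Gauss.ext, x.2]
  rw [hx]
  congr 1
  simp only [mulVec, dotProduct]
  rw [sum_eq_sum_site blk W (g := fun y => Δ x.1 y * ext blk W v y) (fun y hy => by simp [BIJ88PolymerRep5134Gauss.ext, hy])]
  refine Finset.sum_congr rfl fun y _ => ?_
  rw [prec_corner_self_apply]
  simp [BIJ88PolymerRep5134Gauss.ext, y.2]

/-- **`Δ ≥ m·1 ⇒ Δ|_W ≥ m·1`** (a lower bound on the form descends to every region). [cite: BalabanImbrieJaffe1988, p.305 (Sect. 5.13)] -/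
theorem dotProduct_prec_mulVec_ge {m : ℝ} (hΔm : ∀ φ : α → ℝ, m * (φ ⬝ᵥ φ) ≤ φ ⬝ᵥ (Δ *ᵥ φ)) (v : {x : α // blk x ∈ W} → ℝ) :
    m * (v ⬝ᵥ v) ≤ v ⬝ᵥ (prec blk Δ W (corner ℝ W) *ᵥ v) := by
  rw [← ext_dotProduct_ext blk W v v, ← ext_dotProduct_mulVec_ext blk Δ W v]
  exact hΔm _

omit [Fintype I] in
/-- **a linear slot field read on the fields of `W` is `ω ↦ a·ω`** with the coefficient vector `a_x = ℓ(ext δ_x)`.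
[cite: BalabanImbrieJaffe1988, (5.14.2) p.308] -/
theorem linear_ext_eq_dotProduct {ℓ : (α → ℝ) → ℝ} (hℓ : IsLinearMap ℝ ℓ) (ω : {x : α // blk x ∈ W} → ℝ) :
    ℓ (ext blk W ω) = (fun x : {x : α // blk x ∈ W} => ℓ (ext blk W (Pi.single x 1))) ⬝ᵥ ω := by
  let L : ({x : α // blk x ∈ W} → ℝ) →ₗ[ℝ] ℝ := (hℓ.mk' ℓ).comp ((isLinearMap_ext blk W).mk' _)
  have hL : ∀ ω, L ω = ℓ (ext blk W ω) := fun ω => rfl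
  rw [← hL, LinearMap.pi_apply_eq_sum_univ L ω, dotProduct_comm]
  refine Finset.sum_congr rfl fun x _ => ?_
  have hfun : (Pi.single x (1 : ℝ) : {x : α // blk x ∈ W} → ℝ) = fun j => if x = j then 1 else 0 := by
    funext j
    simp [Pi.single_apply, eq_comm]
  show ω x • L _ = ω x * ℓ (ext blk W (Pi.single x 1))
  rw [smul_eq_mul, hL, hfun]

/-- **the variance of a linear slot field under the law of `W`**: `Var[ℓ(ext ω); law(W)] = a·(Δ|_W)⁻¹a` (the law is the Gaussian of precision
`Δ|_W` translated by its mean, gen 11's `fieldLaw_eq_map_gaussProb`; a translation does not change the variance; §2).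
[cite: BalabanImbrieJaffe1988, p.304 (Sect. 5.13); (5.14.2) p.308] -/
theorem variance_linear_fieldLaw (hPD : (prec blk Δ W (corner ℝ W)).PosDef) {ℓ : (α → ℝ) → ℝ} (hℓ : IsLinearMap ℝ ℓ) :
    Var[fun ω => ℓ (ext blk W ω); fieldLaw blk Δ ℱ W] =
      (fun x : {x : α // blk x ∈ W} => ℓ (ext blk W (Pi.single x 1))) ⬝ᵥ
        ((prec blk Δ W (corner ℝ W))⁻¹ *ᵥ fun x : {x : α // blk x ∈ W} => ℓ (ext blk W (Pi.single x 1))) := by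
  set a : {x : α // blk x ∈ W} → ℝ := fun x => ℓ (ext blk W (Pi.single x 1)) with ha
  haveI := isProbabilityMeasure_gaussProb hPD
  have hmeas : Measurable fun ω : {x : α // blk x ∈ W} → ℝ => ℓ (ext blk W ω) :=
    ((LinearMap.continuous_of_finiteDimensional (hℓ.mk' ℓ)).comp (continuous_ext blk W)).measurable
  rw [fieldLaw_eq_map_gaussProb blk Δ ℱ W hPD, variance_map hmeas.aemeasurable (measurable_add_const _).aemeasurable]
  have hcomp : ((fun ω : {x : α // blk x ∈ W} → ℝ => ℓ (ext blk W ω)) ∘ fun ψ => ψ + (prec blk Δ W (corner ℝ W))⁻¹ *ᵥ src blk ℱ W) =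
      fun ψ => a ⬝ᵥ ψ + a ⬝ᵥ ((prec blk Δ W (corner ℝ W))⁻¹ *ᵥ src blk ℱ W) := by
    funext ψ
    simp only [Function.comp_apply]
    rw [linear_ext_eq_dotProduct blk W hℓ, ← ha, dotProduct_add]
  rw [hcomp, variance_add_const (Measurable.aestronglyMeasurable (by fun_prop)), variance_dotProduct_gaussProb hPD]

omit [Fintype I] in
/-- **the coefficient vector of a `Λ`-bounded functional has norm `≤ Λ`**: `‖a‖² ≤ Λ²` when `|ℓ φ| ≤ Λ‖φ‖₂` for all fields `φ`
(`‖a‖² = ℓ(ext a) ≤ Λ‖ext a‖₂ = Λ‖a‖₂`). [cite: BalabanImbrieJaffe1988, (5.14.2) p.308] -/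
theorem dotProduct_coef_self_le {ℓ : (α → ℝ) → ℝ} (hℓ : IsLinearMap ℝ ℓ) {Λ : ℝ} (hΛ0 : 0 ≤ Λ)
    (hΛ : ∀ φ : α → ℝ, |ℓ φ| ≤ Λ * Real.sqrt (φ ⬝ᵥ φ)) :
    (fun x : {x : α // blk x ∈ W} => ℓ (ext blk W (Pi.single x 1))) ⬝ᵥ (fun x : {x : α // blk x ∈ W} => ℓ (ext blk W (Pi.single x 1))) ≤
      Λ ^ 2 := by
  set a : {x : α // blk x ∈ W} → ℝ := fun x => ℓ (ext blk W (Pi.single x 1)) with ha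
  have h1 : a ⬝ᵥ a = ℓ (ext blk W a) := by rw [linear_ext_eq_dotProduct blk W hℓ, ← ha]
  have h2 : a ⬝ᵥ a ≤ Λ * Real.sqrt (a ⬝ᵥ a) := by
    calc a ⬝ᵥ a = ℓ (ext blk W a) := h1
      _ ≤ |ℓ (ext blk W a)| := le_abs_self _
      _ ≤ Λ * Real.sqrt (ext blk W a ⬝ᵥ ext blk W a) := hΛ _
      _ = Λ * Real.sqrt (a ⬝ᵥ a) := by rw [ext_dotProduct_ext]
  have h0 : 0 ≤ a ⬝ᵥ a := Finset.sum_nonneg fun i _ => mul_self_nonneg (a i)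
  have h3 : Real.sqrt (a ⬝ᵥ a) ≤ Λ := by
    rcases (Real.sqrt_nonneg (a ⬝ᵥ a)).eq_or_lt with hz | hpos
    · rw [← hz]; exact hΛ0
    · have : Real.sqrt (a ⬝ᵥ a) * Real.sqrt (a ⬝ᵥ a) ≤ Λ * Real.sqrt (a ⬝ᵥ a) := by rwa [Real.mul_self_sqrt h0]
      exact le_of_mul_le_mul_right this hpos
  calc a ⬝ᵥ a = Real.sqrt (a ⬝ᵥ a) ^ 2 := (Real.sq_sqrt h0).symm
    _ ≤ Λ ^ 2 := pow_le_pow_left₀ (Real.sqrt_nonneg _) h3 2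

/-- **STRUCTURAL VARIANCE BOUND**: `Δ ≥ m·1` (`m > 0`) and `|ℓ φ| ≤ Λ‖φ‖₂` give `Var[ℓ(ext ω); law(W)] ≤ Λ²/m`.
[cite: BalabanImbrieJaffe1988, p.304 (Sect. 5.13); (5.14.2) p.308] -/
theorem variance_linear_fieldLaw_le (hΔ : Δ.PosDef) {m : ℝ} (hm : 0 < m) (hΔm : ∀ φ : α → ℝ, m * (φ ⬝ᵥ φ) ≤ φ ⬝ᵥ (Δ *ᵥ φ))
    {ℓ : (α → ℝ) → ℝ} (hℓ : IsLinearMap ℝ ℓ) {Λ : ℝ} (hΛ0 : 0 ≤ Λ) (hΛ : ∀ φ : α → ℝ, |ℓ φ| ≤ Λ * Real.sqrt (φ ⬝ᵥ φ)) :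
    Var[fun ω => ℓ (ext blk W ω); fieldLaw blk Δ ℱ W] ≤ Λ ^ 2 / m := by
  have hPD := prec_corner_posDef blk Δ hΔ W W
  rw [variance_linear_fieldLaw blk Δ ℱ W hPD hℓ]
  refine (dotProduct_inv_mulVec_le hPD hm (dotProduct_prec_mulVec_ge blk Δ W hΔm) _).trans ?_
  gcongr
  exact dotProduct_coef_self_le blk W hℓ hΛ0 hΛ

/-- **the mean of a linear slot field under the law of `W`** in coefficient form: `E ℓ(ext ω) = a·(Δ|_W)⁻¹ℱ|_W` (gen 11's
`integral_slotField_fieldLaw`: the mean field is `(Δ|_W)⁻¹ℱ|_W`). [cite: BalabanImbrieJaffe1988, p.305 (Sect. 5.13); (5.14.2) p.308] -/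
theorem integral_linear_fieldLaw_eq_dotProduct (hPD : (prec blk Δ W (corner ℝ W)).PosDef) {ℓ : (α → ℝ) → ℝ} (hℓ : IsLinearMap ℝ ℓ) :
    ∫ ω, ℓ (ext blk W ω) ∂(fieldLaw blk Δ ℱ W) =
      (fun x : {x : α // blk x ∈ W} => ℓ (ext blk W (Pi.single x 1))) ⬝ᵥ ((prec blk Δ W (corner ℝ W))⁻¹ *ᵥ src blk ℱ W) := by
  have h := integral_slotField_fieldLaw blk Δ ℱ W (Φ := fun _ : Unit => ℓ) hPD (b := ()) hℓ
  exact h.trans (linear_ext_eq_dotProduct blk W hℓ _)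

/-- **STRUCTURAL MEAN BOUND**: `Δ ≥ m·1` (`m > 0`), `|ℓ φ| ≤ Λ‖φ‖₂` and `‖ℱ|_W‖₂ ≤ F` give `|E ℓ(ext ω)| ≤ ΛF/m`; in particular the mean
vanishes where *"the translation vanishes"* (`ℱ|_W = 0`, p. 307). [cite: BalabanImbrieJaffe1988, p.307 (Sect. 5.13); (5.14.2) p.308] -/
theorem abs_integral_linear_fieldLaw_le (hΔ : Δ.PosDef) {m : ℝ} (hm : 0 < m) (hΔm : ∀ φ : α → ℝ, m * (φ ⬝ᵥ φ) ≤ φ ⬝ᵥ (Δ *ᵥ φ))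
    {ℓ : (α → ℝ) → ℝ} (hℓ : IsLinearMap ℝ ℓ) {Λ : ℝ} (hΛ0 : 0 ≤ Λ) (hΛ : ∀ φ : α → ℝ, |ℓ φ| ≤ Λ * Real.sqrt (φ ⬝ᵥ φ))
    {F : ℝ} (hF0 : 0 ≤ F) (hF : src blk ℱ W ⬝ᵥ src blk ℱ W ≤ F ^ 2) :
    |∫ ω, ℓ (ext blk W ω) ∂(fieldLaw blk Δ ℱ W)| ≤ Λ * F / m := by
  have hPD := prec_corner_posDef blk Δ hΔ W W
  rw [integral_linear_fieldLaw_eq_dotProduct blk Δ ℱ W hPD hℓ]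
  refine (abs_dotProduct_inv_mulVec_le hPD hm (dotProduct_prec_mulVec_ge blk Δ W hΔm) _ _).trans ?_
  have ha : Real.sqrt ((fun x : {x : α // blk x ∈ W} => ℓ (ext blk W (Pi.single x 1))) ⬝ᵥ
      fun x : {x : α // blk x ∈ W} => ℓ (ext blk W (Pi.single x 1))) ≤ Λ := by
    rw [← Real.sqrt_sq hΛ0]
    exact Real.sqrt_le_sqrt (dotProduct_coef_self_le blk W hℓ hΛ0 hΛ)
  have hf : Real.sqrt (src blk ℱ W ⬝ᵥ src blk ℱ W) ≤ F := by
    rw [← Real.sqrt_sq hF0]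
    exact Real.sqrt_le_sqrt hF
  gcongr

end Region

/-! ## §4 The one-cube Gaussian tail from structural data -/

section Tail

variable {α I : Type} [Fintype α] [DecidableEq α] [Fintype I] [DecidableEq I]
  (blk : α → I) (Δ : Matrix α α ℝ) (ℱ : α → ℝ) (W : Finset I)

/-- **THE SUB-GAUSSIAN TAIL OF A SLOT FIELD UNDER THE LAW OF A REGION, FROM STRUCTURAL DATA**: for a slot field that is a linear functional `ℓ₁`
or a modulus `√(ℓ₁² + ℓ₂²)` of two, with `|ℓ_j φ| ≤ Λ‖φ‖₂` (`Λ > 0`), `Δ ≥ m·1` (`m > 0`) and `‖ℱ|_W‖₂ ≤ F`: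
`law(W){a ≤ |Φ_b(ext ω)|} ≤ 4e^{(ΛF/m)²/(2Λ²/m)}e^{−(1/(8Λ²/m))a²}` — gen 13's `tail_slotField_fieldLaw_of_mod` with `μ₀ = ΛF/m`, `v = Λ²/m`
supplied by §3. [cite: BalabanImbrieJaffe1988, p.307 (Sect. 5.13); p.309 (Sect. 5.14)] -/
theorem tail_slotField_fieldLaw_of_struct (hΔ : Δ.PosDef) {m : ℝ} (hm : 0 < m) (hΔm : ∀ φ : α → ℝ, m * (φ ⬝ᵥ φ) ≤ φ ⬝ᵥ (Δ *ᵥ φ))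
    {Φb ℓ₁ ℓ₂ : (α → ℝ) → ℝ} (h₁ : IsLinearMap ℝ ℓ₁) (h₂ : IsLinearMap ℝ ℓ₂)
    (h : (∀ φ, Φb φ = ℓ₁ φ) ∨ (∀ φ, Φb φ = Real.sqrt (ℓ₁ φ ^ 2 + ℓ₂ φ ^ 2)))
    {Λ : ℝ} (hΛ : 0 < Λ) (hΛ₁ : ∀ φ : α → ℝ, |ℓ₁ φ| ≤ Λ * Real.sqrt (φ ⬝ᵥ φ)) (hΛ₂ : ∀ φ : α → ℝ, |ℓ₂ φ| ≤ Λ * Real.sqrt (φ ⬝ᵥ φ))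
    {F : ℝ} (hF0 : 0 ≤ F) (hF : src blk ℱ W ⬝ᵥ src blk ℱ W ≤ F ^ 2) {a : ℝ} (ha : 0 ≤ a) :
    (fieldLaw blk Δ ℱ W).real {ω | a ≤ |Φb (ext blk W ω)|} ≤
      4 * Real.exp ((Λ * F / m) ^ 2 / (2 * (Λ ^ 2 / m))) * Real.exp (-(1 / (8 * (Λ ^ 2 / m)) * a ^ 2)) :=
  BIJ88GaussShellModulus309.tail_slotField_fieldLaw_of_mod blk Δ ℱ W (prec_corner_posDef blk Δ hΔ W W) h₁ h₂ h
    (abs_integral_linear_fieldLaw_le blk Δ ℱ W hΔ hm hΔm h₁ hΛ.le hΛ₁ hF0 hF)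
    (abs_integral_linear_fieldLaw_le blk Δ ℱ W hΔ hm hΔm h₂ hΛ.le hΛ₂ hF0 hF) (by positivity)
    (variance_linear_fieldLaw_le blk Δ ℱ W hΔ hm hΔm h₁ hΛ.le hΛ₁) (variance_linear_fieldLaw_le blk Δ ℱ W hΔ hm hΔm h₂ hΛ.le hΛ₂) ha

end Tail

/-! ## §5 The one-cube part of (5.14.4) with the tail input replaced by structural data -/

section OneCube

variable {α I : Type} [Fintype α] [DecidableEq α] [Fintype I] [DecidableEq I]
  (blk : α → I) (Δ : Matrix α α ℝ) (ℱ : α → ℝ)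
variable (adj : I → I → Prop) [DecidableRel adj]
variable (χ : CutoffProfile) {ι υ : Type*} [DecidableEq ι] [DecidableEq υ]
variable {p ek : ℝ} {B : Finset ι} {Φ : ι → (α → ℝ) → ℝ} {c : ι → ℝ} {Ys : Finset υ} {V : υ → (α → ℝ) → ℝ}
variable (cube : ↥B ⊕ ↥Ys → I)

/-- the two tail constants in closed form: `(ΛF/m)²/(2Λ²/m) = F²/(2m)` and `1/(8Λ²/m) = m/(8Λ²)`. [cite: BalabanImbrieJaffe1988, p.309 (Sect. 5.14)] -/
theorem tail_constants_eq {m Λ : ℝ} (hm : 0 < m) (hΛ : 0 < Λ) (F : ℝ) :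
    (Λ * F / m) ^ 2 / (2 * (Λ ^ 2 / m)) = F ^ 2 / (2 * m) ∧ 1 / (8 * (Λ ^ 2 / m)) = m / (8 * Λ ^ 2) := by
  constructor <;> field_simp

/-- **(5.14.4) ON THE ONE-CUBE POLYMERS, IN THE MODEL, LOCATED READING — THE GAUSSIAN TAIL INPUT DISCHARGED FROM STRUCTURAL DATA**:
p36 gen 15's `BIJ88Ineq5144OneCube.ineq5144_locAct_singleton_of_const` (all-orders constant `Ĉ` for orders `≤ n₀`; `≤ G` slots per cube; terms
`|V(Y)| ≤ K_Y ≤ K₁`; the `e_k`-smallness inequalities) with its hypotheses `hΦm`, `hA`, `hκ`, `htail` REPLACED by: `Δ ≥ m·1` as a form (`m > 0`),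
every χ-slot field a linear functional `ℓ₁` or a modulus `√(ℓ₁² + ℓ₂²)` with `|ℓ_j φ| ≤ Λ‖φ‖₂` (`Λ > 0`; p. 308: `(I − Q_s*Q)A^{(k)}`, `φ^{(k)}`), and
`‖ℱ|_□‖₂ ≤ F` on every cube (p. 307: *"the translation vanishes"* gives `F = 0`); the tail constants become `A = 4e^{F²/(2m)}`, `κ = m/(8Λ²)` (§4).
Conclusion verbatim: `|g₃(H, X₁)| ≤ θ^{|H| + β′|X₁ ∖ loc H|}` on every one-cube polymer `X₁`, for every corner, region, `t ∈ (0,1]`, `|L| ≤ n₀`,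
assignment. [cite: BalabanImbrieJaffe1988, (5.14.4) p.309; p.307 (Sect. 5.13)] -/
theorem ineq5144_locAct_singleton_of_struct [Fintype ι] [Fintype υ] (hp : 1 / 2 < p) {n₀ : ℕ} {C : ℝ} (hC1 : 1 ≤ C)
    (hC : ∀ i, i ≤ n₀ → ∀ (A : ℝ) ⦃q e t : ℝ⦄, q ≠ 0 → 0 < e → 0 < t → t * e ≤ Real.exp (-1) →
      |iteratedDeriv i (fun s => cutoff χ (q * pLog p (s * e)) A) t| ≤ C * t ^ (-(i : ℤ)))
    (hΔ : Δ.PosDef) {m : ℝ} (hm : 0 < m) (hΔm : ∀ φ : α → ℝ, m * (φ ⬝ᵥ φ) ≤ φ ⬝ᵥ (Δ *ᵥ φ))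
    (hχ : ∀ x, 0 ≤ χ.χ₁ x) {c₀ : ℝ} (hc₀ : 0 < c₀) (hcb : ∀ b ∈ B, c₀ ≤ c b) {Λ : ℝ} (hΛ : 0 < Λ)
    (hmod : ∀ b ∈ B, ∃ ℓ₁ ℓ₂ : (α → ℝ) → ℝ, IsLinearMap ℝ ℓ₁ ∧ IsLinearMap ℝ ℓ₂ ∧
      ((∀ φ, Φ b φ = ℓ₁ φ) ∨ (∀ φ, Φ b φ = Real.sqrt (ℓ₁ φ ^ 2 + ℓ₂ φ ^ 2))) ∧
      (∀ φ, |ℓ₁ φ| ≤ Λ * Real.sqrt (φ ⬝ᵥ φ)) ∧ (∀ φ, |ℓ₂ φ| ≤ Λ * Real.sqrt (φ ⬝ᵥ φ)))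
    {F : ℝ} (hF0 : 0 ≤ F) (hF : ∀ i : I, src blk ℱ {i} ⬝ᵥ src blk ℱ {i} ≤ F ^ 2)
    (hV : ∀ Y ∈ Ys, Measurable (V Y)) {KY : υ → ℝ} (hK : ∀ Y ∈ Ys, ∀ φ, |V Y φ| ≤ KY Y)
    {K₁ : ℝ} (hK₁0 : 0 ≤ K₁) (hK₁ : ∀ Y ∈ Ys, KY Y ≤ K₁) {G : ℕ} (hG : ∀ i, (univ.filter fun τ : ↥B ⊕ ↥Ys => cube τ = i).card ≤ G)
    (hek : 0 < ek) (hek1 : ek ≤ Real.exp (-1)) {θ β' : ℝ} (hekθ : ek ≤ θ)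
    (hreg : (n₀ : ℝ) + 1 ≤ m / (8 * Λ ^ 2) * (81 / 100) * c₀ ^ 2 * Real.log ek⁻¹ ^ (2 * p - 1))
    (hpre : C ^ n₀ * (4 * Real.exp (F ^ 2 / (2 * m))) * Real.exp (G * K₁) * ek ≤ 1) (hKθ : ∀ Y ∈ Ys, KY Y * Real.exp (G * K₁) ≤ θ)
    (hvac : Real.exp (G * K₁) * G * (4 * Real.exp (F ^ 2 / (2 * m))) * ek + (Real.exp (G * K₁) - 1) ≤ θ ^ β')
    (Λ' X : Finset I) {t : ℝ} (ht : t ∈ Set.Ioc (0 : ℝ) 1) {L : Type} [Fintype L] [DecidableEq L] (hL : Fintype.card L ≤ n₀)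
    (γ : L → ↥(slotB B Ys cube X) ⊕ ↥(slotY B Ys cube X)) (H : Finset L) (X₁ : Finset I) (hX₁ : X₁.card = 1) :
    |locAct (cubeIn cube X ∘ γ) (actIn blk Δ ℱ adj χ p ek B Φ c Ys V cube Λ' X t γ) H X₁| ≤
      θ ^ ((H.card : ℝ) + β' * ((X₁ \ H.image (cubeIn cube X ∘ γ)).card : ℝ)) := by
  obtain ⟨hc1, hc2⟩ := tail_constants_eq hm hΛ F
  have hΦm : ∀ b ∈ B, Measurable (Φ b) := fun b hb => by
    obtain ⟨ℓ₁, ℓ₂, h₁, h₂, h, -, -⟩ := hmod b hb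
    exact (BIJ88GaussShellModulus309.continuous_and_zero_of_mod h₁ h₂ h).1.measurable
  have htail : ∀ (i : I) (b : ↥B), cube (Sum.inl b) = i → ∀ a : ℝ, 0 ≤ a →
      (fieldLaw blk Δ ℱ {i}).real {ω | a ≤ |Φ b (ext blk {i} ω)|} ≤ 4 * Real.exp (F ^ 2 / (2 * m)) * Real.exp (-(m / (8 * Λ ^ 2) * a ^ 2)) := by
    intro i b _ a ha
    obtain ⟨ℓ₁, ℓ₂, h₁, h₂, h, hΛ₁, hΛ₂⟩ := hmod b b.2
    rw [← hc1, ← hc2]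
    exact tail_slotField_fieldLaw_of_struct blk Δ ℱ {i} hΔ hm hΔm h₁ h₂ h hΛ hΛ₁ hΛ₂ hF0 (hF i) ha
  exact BIJ88Ineq5144OneCube.ineq5144_locAct_singleton_of_const blk Δ ℱ adj χ cube hp hC1 hC hΔ hχ hc₀ hcb hΦm hV hK hK₁0 hK₁ hG
    (by positivity) (by positivity) htail hek hek1 hekθ hreg hpre hKθ hvac Λ' X ht hL γ H X₁ hX₁

end OneCube

end Literature.MathematicalPhysics.QuantumFieldTheory.BalabanImbrieJaffe1984to88.BIJ88SlotFieldGaussBounds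

end
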